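/-
Origin: expansion seat `planner-pub-hodgecm-toy2-g5-0`, handover #11 2026-08-18T09:29:41Z (`HOME/pub-hodgecm-toy2-g5/lean/Toy2g5/ToyCurveTrace.lean`, md5 24840d5e, 295 lines);
landed by the gen-7 packager in gate run 27 as `HodgeCM/Model/Toy/ToyCurveTrace.lean` (import ^import Toy2g5\.ToyPadH0FundDescent\b→import HodgeCM.Model.Toy.ToyPadH0FundDescent ×1; stripped 4 #print/#check/#eval lines).
-/
/-
Copyright: pub-hodgecm formalisation cell (harness21, 2026). New file (not vendored).
Origin: HOME/pub-hodgecm-toy2-g5/lean/Toy2g5/ToyCurveTrace.lean — session planner-pub-hodgecm-toy2-g5-0 (unit pub-hodgecm-toy2-g5,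
CONSISTENCY seat 2, part (6a)(ii), generation 5).  WIP module `Toy2g5.ToyCurveTrace`; intended final place
`HodgeCM/Model/Toy/ToyCurveTrace.lean` (module `HodgeCM.Model.Toy.ToyCurveTrace`).  ONE import to rewrite on landing:
`Toy2g5.ToyPadH0FundDescent` ↦ `HodgeCM.Model.Toy.ToyPadH0FundDescent`.
-/
import Summits.HodgeConjecture.HodgeCM.Model.Toy.ToyPadH0FundDescent
import Summits.HodgeConjecture.HodgeCM.Model.Toy.ToyTrTop

/-!
# F7 `Fact_gysin` is independent: the curve-traced exterior model and its degree-0 double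

`ToyRetrace` / `ToyTrTop` showed that M26 kills every re-tracing of the exterior model on CM SURFACES.  It does not
kill traces of CM CURVES: re-trace the exterior model by a nonzero functional on `H²(C) = ⋀² L_C ≅ ℚ` for the objects
`C` with `rk L_C = 2`, no padding (the CM elliptic curves `A_{(ℚ(ζ₃),Φ)}`, …), and by `0` everywhere else —

  `curveModel := toyModel.withTr curveTr` (`U.withTr tr' := {U with tr := tr'}`, the generic re-tracing; it is
  definitionally `Retrace.retrace exteriorHodgeData curveTr`).

* `curveModel_modelAxioms` — ALL 28 `ModelAxioms` hold (25 are trace-free and transfer verbatim from `toyModel`; M6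
  `Fact_tr_degree` by construction; M26 `Fact_gysin_surface` with `c := 0`, both sides being traces in degree `4 ≠ 2`
  resp. of `y ∪ 0 = 0`; M27 `Fact_deg_diag` because `rk L = 4·[K:ℚ] ≠ 2` on the corner products), and so do N1–N4, F4,
  F5, `Fact_dimProd`, `W_RK4`, `CMProdH0Nontrivial` (trace-free, transferred);
* `curveModel_exists_tr_ne_zero` — the block `Y′ = A_{(ℚ(ζ₃),Φ)}` (`cyclo3`, degree `2`) carries a top class of
  NONZERO trace;
* hence, by `PadH0Fund.not_fact_gysin_of_tr_ne_zero`, **F7 `Fact_gysin` FAILS in the degree-0 double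
  `curveFlat := curveModel♭⁰`** (the projection formula would force `(∫ω)·(0,u) = 0`), while `FundContext curveFlat` holds
  (`fundContext_padH0`);  F7 HOLDS in `toyModel` (`toyModel_fact_gysin`, vacuously: all traces vanish).

Headline `HodgeCM.Toy.fact_gysin_independent : (∃ U, FundContext U ∧ U.Fact_gysin) ∧ (∃ U, FundContext U ∧ ¬ U.Fact_gysin)`:
F7 is independent of `ModelAxioms ∧ N1–N4 ∧ F4 ∧ F5 ∧ Fact_dimProd ∧ W_RK4 ∧ PohlmannSpan ∧ Qw8MilnePos`
(FACTS §1c P5 row F7: 'none filed').  Nothing is cited; Lean + Mathlib axioms only.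
-/

noncomputable section

namespace HodgeCM

open Literature.AlgebraicGeometry.Motives (CMType HodgeStructure)

namespace Universe

variable {U : Universe}

/-- **Re-tracing**: `U` with its trace replaced by `tr'` (everything else, incl. cup products and cycle classes, kept). -/
def withTr (U : Universe) (tr' : (X : U.Var) → (k : ℕ) → (U.Coh X k →ₗ[ℚ] ℚ)) : Universe := { U with tr := tr' }

namespace WithTr

variable {tr' : (X : U.Var) → (k : ℕ) → (U.Coh X k →ₗ[ℚ] ℚ)}

/-- (Ported verbatim from the HodgeCMPerL package; no docstring in the source.) -/
theorem tr_eq (X : U.Var) (k : ℕ) : (U.withTr tr').tr X k = tr' X k := rfl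
/-- (Ported verbatim from the HodgeCMPerL package; no docstring in the source.) -/
theorem dim_eq (X : U.Var) : (U.withTr tr').dim X = U.dim X := rfl

set_option smartUnfolding false in
/-- The 25 trace-free axioms transfer; M6, M26, M27 are the re-tracer's obligations (`smartUnfolding false`: the
statements mentioning the recursively defined `U.cmProd` must unfold it at a variable length). -/
theorem modelAxioms (M : U.ModelAxioms) (h6 : (U.withTr tr').Fact_tr_degree) (h26 : (U.withTr tr').Fact_gysin_surface)
    (h27 : (U.withTr tr').Fact_deg_diag) : (U.withTr tr').ModelAxioms where
  pull_id := M.pull_id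
  pull_comp := M.pull_comp
  pull_cup := M.pull_cup
  pull_hodge := M.pull_hodge
  cup2_hodge := M.cup2_hodge
  tr_degree := h6
  alg_le_hodge := M.alg_le_hodge
  pull_alg := M.pull_alg
  cup_alg := M.cup_alg
  lefschetz11 := M.lefschetz11
  cmAV := M.cmAV
  eigenLine := M.eigenLine
  alphaLine := M.alphaLine
  cmDominated := M.cmDominated
  weilLine_rank := M.weilLine_rank
  weilLine_hodge := M.weilLine_hodge
  pms_dim := M.pms_dim
  lift := M.lift
  cup_comm1 := M.cup_comm1
  cup_interchange := M.cup_interchange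
  kunneth1 := M.kunneth1
  H1_rank := M.H1_rank
  H4_span := M.H4_span
  cmEnd := M.cmEnd
  conjIsogeny := M.conjIsogeny
  gysin_surface := h26
  deg_diag := h27
  algDuality := M.algDuality

set_option smartUnfolding false in
/-- (Ported verbatim from the HodgeCMPerL package; no docstring in the source.) -/
theorem fact_cupExterior_iff : (U.withTr tr').Fact_cupExterior ↔ U.Fact_cupExterior := Iff.rfl
set_option smartUnfolding false in
/-- (Ported verbatim from the HodgeCMPerL package; no docstring in the source.) -/
theorem fact_cup_hodge_iff : (U.withTr tr').Fact_cup_hodge ↔ U.Fact_cup_hodge := Iff.rfl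
set_option smartUnfolding false in
/-- (Ported verbatim from the HodgeCMPerL package; no docstring in the source.) -/
theorem fact_pull_H0_iff : (U.withTr tr').Fact_pull_H0 ↔ U.Fact_pull_H0 := Iff.rfl
set_option smartUnfolding false in
/-- (Ported verbatim from the HodgeCMPerL package; no docstring in the source.) -/
theorem fact_hodge_F0_iff : (U.withTr tr').Fact_hodge_F0 ↔ U.Fact_hodge_F0 := Iff.rfl
set_option smartUnfolding false in
/-- (Ported verbatim from the HodgeCMPerL package; no docstring in the source.) -/
theorem fact_cupAlg_iff : (U.withTr tr').Fact_cupAlg ↔ U.Fact_cupAlg := Iff.rfl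
set_option smartUnfolding false in
/-- (Ported verbatim from the HodgeCMPerL package; no docstring in the source.) -/
theorem fact_cupAssoc_iff : (U.withTr tr').Fact_cupAssoc ↔ U.Fact_cupAssoc := Iff.rfl
set_option smartUnfolding false in
/-- (Ported verbatim from the HodgeCMPerL package; no docstring in the source.) -/
theorem fact_dimProd_iff : (U.withTr tr').Fact_dimProd ↔ U.Fact_dimProd := Iff.rfl
set_option smartUnfolding false in
/-- (Ported verbatim from the HodgeCMPerL package; no docstring in the source.) -/
theorem w_RK4_iff : (U.withTr tr').W_RK4 ↔ U.W_RK4 := Iff.rfl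
set_option smartUnfolding false in
/-- (Ported verbatim from the HodgeCMPerL package; no docstring in the source.) -/
theorem cmProdH0Nontrivial_iff : (U.withTr tr').CMProdH0Nontrivial ↔ U.CMProdH0Nontrivial := Iff.rfl

end WithTr

end Universe

namespace Toy

open Universe

/-! ### `ℚ(ζ₃)`: a CM field of degree 2 -/

set_option backward.isDefEq.respectTransparency false in
/-- (Ported verbatim from the HodgeCMPerL package; no docstring in the source.) -/
instance cyclotomicField3_isCMField : NumberField.IsCMField (CyclotomicField 3 ℚ) :=
  IsCyclotomicExtension.Rat.isCMField (CyclotomicField 3 ℚ) (S := ({3} : Set ℕ))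
    ⟨3, Set.mem_singleton 3, by norm_num⟩

/-- `ℚ(ζ₃)` as a bundled CM field. -/
def cyclo3 : CMField := ⟨CyclotomicField 3 ℚ⟩

set_option backward.isDefEq.respectTransparency false in
/-- (Ported verbatim from the HodgeCMPerL package; no docstring in the source.) -/
theorem cyclo3_finrank : Module.finrank ℚ cyclo3 = 2 := by
  have h := IsCyclotomicExtension.finrank (n := 3) (K := ℚ) (CyclotomicField 3 ℚ)
    (Polynomial.cyclotomic.irreducible_rat (by norm_num))
  rw [Nat.totient_prime (by norm_num : Nat.Prime 3)] at h
  exact h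

/-! ### The curve trace and the curve-traced exterior model -/

open Classical in
/-- some coordinate functional of `⋀ᵏ L_X` (nonzero as soon as `⋀ᵏ L_X ≠ 0`), `0` if `⋀ᵏ L_X = 0` -/
def topCoord (X : Obj) (k : ℕ) : ↥(⋀[ℚ]^k X.L) →ₗ[ℚ] ℚ :=
  if h : Nonempty (Module.Free.ChooseBasisIndex ℚ ↥(⋀[ℚ]^k X.L)) then
    (Module.Free.chooseBasis ℚ ↥(⋀[ℚ]^k X.L)).coord h.some
  else 0

/-- **The curve trace**: `topCoord` on `H²` of the unpadded rank-2 objects (CM elliptic curves), `0` elsewhere. -/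
def curveTr (X : Obj) (k : ℕ) : ↥(⋀[ℚ]^k X.L) →ₗ[ℚ] ℚ :=
  if Module.finrank ℚ X.L = 2 ∧ X.extra = 0 ∧ k = 2 then topCoord X k else 0

/-- **The curve-traced exterior model**: `toyModel` with its trace replaced by `curveTr`. -/
def curveModel : Universe := toyModel.withTr curveTr

/-- (Ported verbatim from the HodgeCMPerL package; no docstring in the source.) -/
theorem curveModel_eq_retrace : curveModel = Retrace.retrace exteriorHodgeData curveTr := rfl

/-- (Ported verbatim from the HodgeCMPerL package; no docstring in the source.) -/
theorem tr_curveModel (X : Obj) (k : ℕ) : curveModel.tr X k = curveTr X k := rfl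

/-- (Ported verbatim from the HodgeCMPerL package; no docstring in the source.) -/
theorem curveTr_of_not {X : Obj} {k : ℕ} (h : ¬ (Module.finrank ℚ X.L = 2 ∧ X.extra = 0 ∧ k = 2)) : curveTr X k = 0 :=
  if_neg h

/-- (Ported verbatim from the HodgeCMPerL package; no docstring in the source.) -/
theorem curveTr_of {X : Obj} {k : ℕ} (h : Module.finrank ℚ X.L = 2 ∧ X.extra = 0 ∧ k = 2) : curveTr X k = topCoord X k :=
  if_pos h

/-- (Ported verbatim from the HodgeCMPerL package; no docstring in the source.) -/
theorem dim_curveModel (X : Obj) : curveModel.dim X = Module.finrank ℚ X.L / 2 + X.extra := rfl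

/-- `rk L = 4·[K:ℚ]` on the corner product `A_{Φ₀} × A_{Φ₁} × A_{Φ₂} × A_{Φ₃}`. -/
theorem finrank_L_prod4 (K : CMField) (Φ : Fin 4 → CMType K) :
    Module.finrank ℚ (curveModel.prod4 K Φ).L = 4 * Module.finrank ℚ K := by
  change Module.finrank ℚ
      ((((cmObj K (Φ 0)).prod (cmObj K (Φ 1))).prod (cmObj K (Φ 2))).prod (cmObj K (Φ 3))).L = _
  simp only [finrank_L_prod, finrank_L_cmObj]
  ring

/-- M6 for the curve trace (by construction). -/
theorem curveModel_fact_tr_degree : curveModel.Fact_tr_degree := fun X k hk =>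
  curveTr_of_not (X := X) (k := k) (by
    rintro ⟨hrk, hex, rfl⟩
    exact hk (by rw [dim_curveModel, hrk, hex]))

/-- M26 for the curve trace: `c := 0`; the left side is a trace in degree `4 ≠ 2`. -/
theorem curveModel_fact_gysin_surface : curveModel.Fact_gysin_surface := by
  intro S X f _
  refine ⟨0, Submodule.zero_mem _, fun y => ?_⟩
  rw [map_zero, map_zero]
  exact DFunLike.congr_fun (curveTr_of_not (X := S) (k := 4) (by rintro ⟨-, -, h⟩; omega)) _

/-- M27 for the curve trace: the corner products have `rk L = 4·[K:ℚ] ≠ 2`, so both sides vanish. -/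
theorem curveModel_fact_deg_diag : curveModel.Fact_deg_diag := by
  intro K Φ a M _ k
  have h0 : curveModel.tr (curveModel.prod4 K Φ) k = 0 :=
    curveTr_of_not (X := curveModel.prod4 K Φ) (k := k) (by
      rintro ⟨hrk, -, -⟩
      rw [finrank_L_prod4] at hrk
      have hpos : 0 < Module.finrank ℚ K := Module.finrank_pos
      omega)
  rw [h0, LinearMap.zero_comp, smul_zero]

/-- **`ModelAxioms curveModel`**: the 25 trace-free axioms transfer from `toyModel`; M6, M26, M27 as above. -/
theorem curveModel_modelAxioms : curveModel.ModelAxioms :=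
  WithTr.modelAxioms toyModel_modelAxioms curveModel_fact_tr_degree curveModel_fact_gysin_surface curveModel_fact_deg_diag

/-- (Ported verbatim from the HodgeCMPerL package; no docstring in the source.) -/
theorem curveModel_fact_cupExterior : curveModel.Fact_cupExterior := WithTr.fact_cupExterior_iff.mpr toyModel_fact_cupExterior
/-- (Ported verbatim from the HodgeCMPerL package; no docstring in the source.) -/
theorem curveModel_fact_cup_hodge : curveModel.Fact_cup_hodge := WithTr.fact_cup_hodge_iff.mpr toyModel_fact_cup_hodge
/-- (Ported verbatim from the HodgeCMPerL package; no docstring in the source.) -/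
theorem curveModel_fact_pull_H0 : curveModel.Fact_pull_H0 := WithTr.fact_pull_H0_iff.mpr toyModel_fact_pull_H0
/-- (Ported verbatim from the HodgeCMPerL package; no docstring in the source.) -/
theorem curveModel_fact_hodge_F0 : curveModel.Fact_hodge_F0 := WithTr.fact_hodge_F0_iff.mpr toyModel_fact_hodge_F0
/-- (Ported verbatim from the HodgeCMPerL package; no docstring in the source.) -/
theorem curveModel_fact_cupAlg : curveModel.Fact_cupAlg := WithTr.fact_cupAlg_iff.mpr fact_cupAlg
/-- (Ported verbatim from the HodgeCMPerL package; no docstring in the source.) -/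
theorem curveModel_fact_cupAssoc : curveModel.Fact_cupAssoc := WithTr.fact_cupAssoc_iff.mpr (fact_cupAssoc exteriorHodgeData)
/-- (Ported verbatim from the HodgeCMPerL package; no docstring in the source.) -/
theorem curveModel_fact_dimProd : curveModel.Fact_dimProd := WithTr.fact_dimProd_iff.mpr toyModel_fact_dimProd
/-- (Ported verbatim from the HodgeCMPerL package; no docstring in the source.) -/
theorem curveModel_w_rk4 : curveModel.W_RK4 := WithTr.w_RK4_iff.mpr toyModel_w_rk4
/-- (Ported verbatim from the HodgeCMPerL package; no docstring in the source.) -/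
theorem curveModel_cmProdH0Nontrivial : curveModel.CMProdH0Nontrivial :=
  WithTr.cmProdH0Nontrivial_iff.mpr (cmProdH0Nontrivial exteriorHodgeData)

/-- **The CM elliptic curve `A_{(ℚ(ζ₃),Φ)}` carries a top class of nonzero trace in `curveModel`.** -/
theorem curveModel_exists_tr_ne_zero :
    ∃ (F : CMField) (n m : ℕ) (Ξ : Fin (n + 1 + (m + 1)) → CMType F)
      (ω : curveModel.Coh (curveModel.cmProd F (blkB Ξ)) (2 * curveModel.dim (curveModel.cmProd F (blkB Ξ)))),
      curveModel.tr _ _ ω ≠ 0 := by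
  let Ξ : Fin (0 + 1 + (0 + 1)) → CMType cyclo3 := fun _ => stdCMType cyclo3
  have hrk : Module.finrank ℚ (curveModel.cmProd cyclo3 (blkB Ξ)).L = 2 := by
    change Module.finrank ℚ (cmObj cyclo3 (blkB Ξ 0)).L = 2
    rw [finrank_L_cmObj, cyclo3_finrank]
  have hex : (curveModel.cmProd cyclo3 (blkB Ξ)).extra = 0 := rfl
  have hk : 2 * curveModel.dim (curveModel.cmProd cyclo3 (blkB Ξ)) = 2 := by rw [dim_curveModel, hrk, hex]
  have hfin : Module.finrank ℚ
      ↥(⋀[ℚ]^(2 * curveModel.dim (curveModel.cmProd cyclo3 (blkB Ξ))) (curveModel.cmProd cyclo3 (blkB Ξ)).L) = 1 := by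
    haveI : Module.Free ℚ (curveModel.cmProd cyclo3 (blkB Ξ)).L := Module.Free.of_divisionRing ℚ _
    rw [exteriorPower.finrank_eq, hrk, hk]
    rfl
  haveI : Nontrivial ↥(⋀[ℚ]^(2 * curveModel.dim (curveModel.cmProd cyclo3 (blkB Ξ))) (curveModel.cmProd cyclo3 (blkB Ξ)).L) :=
    Module.nontrivial_of_finrank_eq_succ hfin
  have hne : Nonempty (Module.Free.ChooseBasisIndex ℚ
      ↥(⋀[ℚ]^(2 * curveModel.dim (curveModel.cmProd cyclo3 (blkB Ξ))) (curveModel.cmProd cyclo3 (blkB Ξ)).L)) :=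
    (Module.Free.chooseBasis ℚ _).index_nonempty
  have key : topCoord (curveModel.cmProd cyclo3 (blkB Ξ)) (2 * curveModel.dim (curveModel.cmProd cyclo3 (blkB Ξ)))
      (Module.Free.chooseBasis ℚ ↥(⋀[ℚ]^(2 * curveModel.dim (curveModel.cmProd cyclo3 (blkB Ξ))) (curveModel.cmProd cyclo3 (blkB Ξ)).L) hne.some) = 1 := by
    rw [topCoord, dif_pos hne, Module.Basis.coord_apply, Module.Basis.repr_self, Finsupp.single_eq_same]
  refine ⟨cyclo3, 0, 0, Ξ, Module.Free.chooseBasis ℚ ↥(⋀[ℚ]^(2 * curveModel.dim (curveModel.cmProd cyclo3 (blkB Ξ))) (curveModel.cmProd cyclo3 (blkB Ξ)).L) hne.some, ?_⟩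
  rw [Ne, show curveModel.tr (curveModel.cmProd cyclo3 (blkB Ξ)) (2 * curveModel.dim (curveModel.cmProd cyclo3 (blkB Ξ)))
      (Module.Free.chooseBasis ℚ ↥(⋀[ℚ]^(2 * curveModel.dim (curveModel.cmProd cyclo3 (blkB Ξ))) (curveModel.cmProd cyclo3 (blkB Ξ)).L) hne.some) = _ from DFunLike.congr_fun (curveTr_of ⟨hrk, hex, hk⟩) _, key]
  exact one_ne_zero

/-! ### The degree-0 double `curveFlat := curveModel♭⁰`: `FundContext` holds, F7 fails -/

/-- `FundContext` of `U♭⁰` from the trace-free facts of `U` (generic; `h0PadModel_fundContext` is the case `U = toyModel`). -/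
theorem fundContext_padH0 {U : Universe} (M : U.ModelAxioms) (hd : U.Fact_dimProd) (hN1 : U.Fact_cupExterior)
    (hN2 : U.Fact_cup_hodge) (hN3 : U.Fact_pull_H0) (hN4 : U.Fact_hodge_F0) (hF4 : U.Fact_cupAlg) (hF5 : U.Fact_cupAssoc)
    (hW : U.W_RK4) : FundContext (U.padH0 U.padDatumH0) :=
  ⟨PadH0Fund.modelAxioms M hd, PadH0Fund.fact_cupExterior_iff.mpr hN1, PadH0Fund.fact_cup_hodge hN2,
    PadH0Fund.fact_pull_H0_iff.mpr hN3, PadH0Fund.fact_hodge_F0_iff.mpr hN4, PadH0Fund.fact_cupAlg hF4,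
    PadH0Fund.fact_cupAssoc hF5, PadH0Fund.fact_dimProd_iff.mpr hd, PadH0Fund.w_RK4_iff.mpr hW,
    PadH0Fund.pohlmannSpan M hd hN1 hN2 hN3 hN4, PadH0Fund.qw8MilnePos M hd hN1 hN2 hN3 hN4 hF4 hF5⟩

/-- **`curveFlat := curveModel♭⁰`** (pad `H⁰` by a second copy of type `(0,0)`). -/
def curveFlat : Universe := curveModel.padH0 curveModel.padDatumH0

/-- (Ported verbatim from the HodgeCMPerL package; no docstring in the source.) -/
theorem curveFlat_def : curveFlat = curveModel.padH0 curveModel.padDatumH0 := rfl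

/-- (Ported verbatim from the HodgeCMPerL package; no docstring in the source.) -/
theorem curveFlat_fundContext : FundContext curveFlat :=
  fundContext_padH0 curveModel_modelAxioms curveModel_fact_dimProd curveModel_fact_cupExterior curveModel_fact_cup_hodge
    curveModel_fact_pull_H0 curveModel_fact_hodge_F0 curveModel_fact_cupAlg curveModel_fact_cupAssoc curveModel_w_rk4

/-- **F7 `Fact_gysin` FAILS in `curveFlat`.** -/
theorem not_curveFlat_fact_gysin : ¬ curveFlat.Fact_gysin :=
  PadH0Fund.not_fact_gysin_of_tr_ne_zero curveModel_modelAxioms curveModel_fact_dimProd curveModel_cmProdH0Nontrivial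
    curveModel_exists_tr_ne_zero

/-- … and so do F7d, F7d-B, `Fact_unitH0`, N5, `Qw8MilneZero`, COR-CM (as in every `U♭⁰`). -/
theorem curveFlat_profile :
    FundContext curveFlat ∧ ¬ curveFlat.Fact_gysin ∧ ¬ curveFlat.Fact_gysinDescent ∧ ¬ curveFlat.Fact_gysinDescentB ∧
      ¬ curveFlat.Fact_unitH0 ∧ ¬ curveFlat.Fact_fundClass ∧ ¬ curveFlat.Qw8MilneZero ∧ ¬ curveFlat.HC_CM :=
  ⟨curveFlat_fundContext, not_curveFlat_fact_gysin,
    PadH0Fund.not_fact_gysinDescent curveModel_modelAxioms curveModel_fact_dimProd curveModel_cmProdH0Nontrivial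
      (curveModel_exists_tr_ne_zero.imp fun F ⟨n, m, Ξ, ω, h⟩ => ⟨n, m, Ξ, ω, fun h0 => h (by rw [h0, map_zero])⟩),
    PadH0Fund.not_fact_gysinDescentB curveModel_modelAxioms curveModel_fact_dimProd curveModel_cmProdH0Nontrivial
      (curveModel_exists_tr_ne_zero.imp fun F ⟨n, m, Ξ, ω, h⟩ => ⟨n, m, Ξ, ω, fun h0 => h (by rw [h0, map_zero])⟩),
    PadH0Fund.not_fact_unitH0 curveModel_cmProdH0Nontrivial,
    PadH0Fund.not_fact_fundClass curveModel_cmProdH0Nontrivial,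
    PadH0Fund.not_qw8MilneZero curveModel_fact_pull_H0 curveModel_cmProdH0Nontrivial,
    PadH0Fund.not_hc_cm curveModel_modelAxioms curveModel_cmProdH0Nontrivial⟩

/-- **F7 `Fact_gysin` is INDEPENDENT of `ModelAxioms ∧ N1–N4 ∧ F4 ∧ F5 ∧ Fact_dimProd ∧ W_RK4 ∧ PohlmannSpan ∧ Qw8MilnePos`**
(`toyModel`: true; `curveFlat`: false). -/
theorem fact_gysin_independent :
    (∃ U : Universe, FundContext U ∧ U.Fact_gysin) ∧ (∃ U : Universe, FundContext U ∧ ¬ U.Fact_gysin) :=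
  ⟨⟨toyModel, toyModel_fundContext, toyModel_fact_gysin⟩, ⟨curveFlat, curveFlat_fundContext, not_curveFlat_fact_gysin⟩⟩

/-- (Ported verbatim from the HodgeCMPerL package; no docstring in the source.) -/
theorem not_fact_gysin_of_fundContext : ¬ ∀ U : Universe, FundContext U → U.Fact_gysin :=
  fun h => not_curveFlat_fact_gysin (h curveFlat curveFlat_fundContext)


end Toy

end HodgeCM

end
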